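import Mathlib.MeasureTheory.Integral.Lebesgue.Add
import Mathlib.MeasureTheory.Measure.Prod
import Mathlib.Probability.Distributions.Gaussian.Real
import HarnessLib

/-!
# One-dimensional coercivity of the hard-rod collision form (Baranger–Mouhot intermediate velocity trick)

For a probability measure `μ` on `ℝ` such that every point `c` sees mass at least `m₀ > 0` at
distance `≥ 2` (`μ {t | 2 ≤ |t - c|} ≥ m₀`), and every measurable `a : ℝ → ℝ`,

`∫∫ (a c - a s)² dμ dμ ≤ (1 + 4/m₀) ∫∫ |c - s| (a c - a s)² dμ dμ`

(as `lintegral`s of `ENNReal.ofReal`, so that no integrability hypothesis is needed). This is the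
`d = 1` instance of the "intermediate collision" argument of Baranger–Mouhot (Rev. Mat. Iberoam. 21
(2005), proof of Thm 1.1): pairs `(c, s)` with `|c - s| < 1`, on which the hard-sphere weight
`|c - s|` degenerates, are routed through a third velocity `t` with `|t - c| ≥ 2` (hence
`|t - s| ≥ 1`). For the standard Gaussian `γ₁` one may take `m₀ = γ₁ [2, ∞)`.

It is the one-dimensional input of the spectral-gap proof for the linearised hard-sphere
Boltzmann operator (`Literature.Analysis.UnboundedOperators.LinearizedBoltzmann`): along every
impact direction `ω` the hard-sphere Dirichlet form restricted to the `ω`-fibre is exactly the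
form `∫∫ |c - s| (a c - a s)² dγ₁ dγ₁`.

## References
* C. Baranger, C. Mouhot, *Explicit spectral gap estimates for the linearized Boltzmann and Landau
  operators with hard potentials*, Rev. Mat. Iberoam. 21 (2005) 819–841, §2.
* C. Mouhot, *Explicit coercivity estimates for the linearized Boltzmann and Landau operators*,
  Comm. PDE 31 (2006) 1321–1348, §2.
-/

open MeasureTheory
open scoped ENNReal

namespace Literature.Analysis.UnboundedOperators

noncomputable section

/-- `(x - z)² ≤ 2 (x - y)² + 2 (y - z)²`. [folklore] -/
theorem sq_sub_le_two_mul_sq_add (x y z : ℝ) :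
    (x - z) ^ 2 ≤ 2 * (x - y) ^ 2 + 2 * (y - z) ^ 2 := by
  nlinarith [sq_nonneg (x - 2 * y + z)]

variable {μ : Measure ℝ} [IsProbabilityMeasure μ]

/-- The hard-rod weight kernel `K(c, s) = |c - s| (a c - a s)²` as an `ℝ≥0∞`-valued function is
jointly measurable. [folklore] -/
theorem measurable_hardRodKernel {a : ℝ → ℝ} (ha : Measurable a) :
    Measurable fun p : ℝ × ℝ => ENNReal.ofReal (|p.1 - p.2| * (a p.1 - a p.2) ^ 2) := by
  refine ENNReal.measurable_ofReal.comp ?_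
  exact ((measurable_fst.sub measurable_snd).abs).mul
    (((ha.comp measurable_fst).sub (ha.comp measurable_snd)).pow_const 2)

omit [IsProbabilityMeasure μ] in
/-- **Pointwise intermediate-velocity bound.** If `|c - s| < 1` and `μ {t | 2 ≤ |t - c|} ≥ m₀`, then
`m₀ (a c - a s)² ≤ ∫ 2 |c - t| (a c - a t)² + 2 |t - s| (a t - a s)² dμ(t)`. [cite: BarangerMouhot2005, §2 (proof of Thm 1.1)] -/
theorem mul_sq_sub_le_lintegral_intermediate {a : ℝ → ℝ} (m₀ : ℝ≥0∞)
    (hm : ∀ c, m₀ ≤ μ {t | 2 ≤ |t - c|}) {c s : ℝ} (hcs : |c - s| < 1) :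
    m₀ * ENNReal.ofReal ((a c - a s) ^ 2) ≤
      ∫⁻ t, (2 * ENNReal.ofReal (|c - t| * (a c - a t) ^ 2) +
        2 * ENNReal.ofReal (|t - s| * (a t - a s) ^ 2)) ∂μ := by
  calc m₀ * ENNReal.ofReal ((a c - a s) ^ 2)
      ≤ μ {t | 2 ≤ |t - c|} * ENNReal.ofReal ((a c - a s) ^ 2) := by gcongr; exact hm c
    _ = ∫⁻ t, {t | 2 ≤ |t - c|}.indicator (fun _ => ENNReal.ofReal ((a c - a s) ^ 2)) t ∂μ := by
        have hS : MeasurableSet {t : ℝ | 2 ≤ |t - c|} :=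
          measurableSet_le measurable_const ((measurable_id.sub measurable_const).abs)
        rw [lintegral_indicator_const hS, mul_comm]
    _ ≤ _ := by
        refine lintegral_mono fun t => ?_
        by_cases ht : 2 ≤ |t - c|
        · rw [Set.indicator_of_mem (show t ∈ {t | 2 ≤ |t - c|} from ht)]
          have h1 : (1 : ℝ) ≤ |c - t| := by rw [abs_sub_comm]; linarith
          have h2 : (1 : ℝ) ≤ |t - s| := by
            have := abs_sub_abs_le_abs_sub (t - c) (s - c)
            have h' : |s - c| < 1 := by rw [abs_sub_comm]; exact hcs
            rw [show t - c - (s - c) = t - s by ring] at this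
            linarith
          have hsq := sq_sub_le_two_mul_sq_add (a c) (a t) (a s)
          have hA : (a c - a t) ^ 2 ≤ |c - t| * (a c - a t) ^ 2 := by
            nlinarith [sq_nonneg (a c - a t)]
          have hB : (a t - a s) ^ 2 ≤ |t - s| * (a t - a s) ^ 2 := by
            nlinarith [sq_nonneg (a t - a s)]
          calc ENNReal.ofReal ((a c - a s) ^ 2)
              ≤ ENNReal.ofReal (2 * (|c - t| * (a c - a t) ^ 2) + 2 * (|t - s| * (a t - a s) ^ 2)) :=
                ENNReal.ofReal_le_ofReal (by linarith)
            _ = 2 * ENNReal.ofReal (|c - t| * (a c - a t) ^ 2) +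
                  2 * ENNReal.ofReal (|t - s| * (a t - a s) ^ 2) := by
                rw [ENNReal.ofReal_add (by positivity) (by positivity),
                  ENNReal.ofReal_mul (by norm_num), ENNReal.ofReal_mul (by norm_num)]
                simp
        · rw [Set.indicator_of_notMem (show t ∉ {t | 2 ≤ |t - c|} from ht)]
          exact bot_le

/-- **One-dimensional hard-rod coercivity** (Baranger–Mouhot's intermediate-collision argument in
dimension one). For a probability measure `μ` on `ℝ` with `μ {t | 2 ≤ |t - c|} ≥ m₀ > 0` for all
`c`, and measurable `a`,
`∫∫ (a c - a s)² dμ dμ ≤ (1 + 4 m₀⁻¹) ∫∫ |c - s| (a c - a s)² dμ dμ`. [cite: BarangerMouhot2005, §2 (proof of Thm 1.1)] -/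
theorem lintegral_sq_sub_le_hardRod {a : ℝ → ℝ} (ha : Measurable a) (m₀ : ℝ≥0∞) (hm₀ : m₀ ≠ 0)
    (hm : ∀ c, m₀ ≤ μ {t | 2 ≤ |t - c|}) :
    ∫⁻ c, ∫⁻ s, ENNReal.ofReal ((a c - a s) ^ 2) ∂μ ∂μ ≤
      (1 + 4 * m₀⁻¹) * ∫⁻ c, ∫⁻ s, ENNReal.ofReal (|c - s| * (a c - a s) ^ 2) ∂μ ∂μ := by
  -- notation
  set K : ℝ → ℝ → ℝ≥0∞ := fun c s => ENNReal.ofReal (|c - s| * (a c - a s) ^ 2) with hK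
  have hKm : Measurable fun p : ℝ × ℝ => K p.1 p.2 := measurable_hardRodKernel ha
  have hKc : ∀ c, Measurable fun s => K c s := fun c => hKm.comp measurable_prodMk_left
  have hKs : ∀ s, Measurable fun c => K c s := fun s => hKm.comp measurable_prodMk_right
  have hm₀top : m₀ ≠ ⊤ := ne_top_of_le_ne_top (measure_ne_top μ _) (hm 0)
  -- pointwise splitting according to `|c - s| ≥ 1` or `< 1`
  have hpt : ∀ c s, ENNReal.ofReal ((a c - a s) ^ 2) ≤
      K c s + m₀⁻¹ * ∫⁻ t, (2 * K c t + 2 * K t s) ∂μ := by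
    intro c s
    by_cases hcs : |c - s| < 1
    · have h := mul_sq_sub_le_lintegral_intermediate (μ := μ) (a := a) m₀ hm hcs
      calc ENNReal.ofReal ((a c - a s) ^ 2)
          = m₀⁻¹ * (m₀ * ENNReal.ofReal ((a c - a s) ^ 2)) := by
            rw [← mul_assoc, ENNReal.inv_mul_cancel hm₀ hm₀top, one_mul]
        _ ≤ m₀⁻¹ * ∫⁻ t, (2 * K c t + 2 * K t s) ∂μ := by gcongr
        _ ≤ _ := le_add_self
    · have h1 : (1 : ℝ) ≤ |c - s| := le_of_not_gt hcs
      calc ENNReal.ofReal ((a c - a s) ^ 2) ≤ K c s :=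
            ENNReal.ofReal_le_ofReal (by nlinarith [sq_nonneg (a c - a s)])
        _ ≤ _ := le_self_add
  -- the auxiliary integrals
  set 𝒦 := ∫⁻ c, ∫⁻ s, K c s ∂μ ∂μ with h𝒦
  have hm1 : Measurable fun c => ∫⁻ t, K c t ∂μ := hKm.lintegral_prod_right'
  have hm2 : Measurable fun s => ∫⁻ t, K t s ∂μ :=
    (hKm.comp measurable_swap).lintegral_prod_right'
  have hsw : ∫⁻ s, ∫⁻ t, K t s ∂μ ∂μ = 𝒦 := by
    rw [h𝒦, lintegral_lintegral_swap]
    exact (hKm.comp measurable_swap).aemeasurable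
  have hsplit : ∀ c s, ∫⁻ t, (2 * K c t + 2 * K t s) ∂μ =
      2 * ∫⁻ t, K c t ∂μ + 2 * ∫⁻ t, K t s ∂μ := fun c s => by
    rw [lintegral_add_left ((hKc c).const_mul 2), lintegral_const_mul _ (hKc c),
      lintegral_const_mul _ (hKs s)]
  have hinner : ∀ c, ∫⁻ s, (K c s + m₀⁻¹ * ∫⁻ t, (2 * K c t + 2 * K t s) ∂μ) ∂μ =
      ∫⁻ s, K c s ∂μ + m₀⁻¹ * (2 * ∫⁻ t, K c t ∂μ + 2 * 𝒦) := fun c => by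
    rw [lintegral_add_left (hKc c), lintegral_const_mul' _ _ (ENNReal.inv_ne_top.2 hm₀)]
    simp_rw [hsplit]
    rw [lintegral_add_left measurable_const, lintegral_const, measure_univ, mul_one,
      lintegral_const_mul _ hm2, hsw]
  -- integrate the pointwise bound
  calc ∫⁻ c, ∫⁻ s, ENNReal.ofReal ((a c - a s) ^ 2) ∂μ ∂μ
      ≤ ∫⁻ c, ∫⁻ s, (K c s + m₀⁻¹ * ∫⁻ t, (2 * K c t + 2 * K t s) ∂μ) ∂μ ∂μ :=
        lintegral_mono fun c => lintegral_mono fun s => hpt c s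
    _ = ∫⁻ c, (∫⁻ s, K c s ∂μ + m₀⁻¹ * (2 * ∫⁻ t, K c t ∂μ + 2 * 𝒦)) ∂μ := by
        simp_rw [hinner]
    _ = 𝒦 + m₀⁻¹ * (2 * 𝒦 + 2 * 𝒦) := by
        rw [lintegral_add_left hm1, lintegral_const_mul' _ _ (ENNReal.inv_ne_top.2 hm₀),
          lintegral_add_right _ measurable_const, lintegral_const_mul _ hm1, lintegral_const,
          measure_univ, mul_one]
    _ = (1 + 4 * m₀⁻¹) * 𝒦 := by ring


/-! ### The standard Gaussian case -/

open ProbabilityTheory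

/-- A set of positive Lebesgue measure has positive standard Gaussian measure (the Gaussian density
is everywhere positive). [folklore] -/
theorem gaussianReal_pos_of_volume_pos {s : Set ℝ} (hs : 0 < volume s) :
    0 < gaussianReal 0 1 s := by
  rw [gaussianReal_apply _ one_ne_zero, setLIntegral_pos_iff (measurable_gaussianPDF _ _),
    support_gaussianPDF one_ne_zero, Set.univ_inter]
  exact hs

/-- For the standard Gaussian `γ₁` and every `c`:
`min (γ₁ [2, ∞)) (γ₁ (-∞, -2]) ≤ γ₁ {t | 2 ≤ |t - c|}` (take `t ≥ 2` if `c ≤ 0`, `t ≤ -2` if `c ≥ 0`). [folklore] -/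
theorem min_gaussianReal_le_measure_two_le_abs_sub (c : ℝ) :
    min (gaussianReal 0 1 (Set.Ici 2)) (gaussianReal 0 1 (Set.Iic (-2))) ≤
      gaussianReal 0 1 {t | 2 ≤ |t - c|} := by
  rcases le_total c 0 with hc | hc
  · refine (min_le_left _ _).trans (measure_mono fun t (ht : 2 ≤ t) => ?_)
    show 2 ≤ |t - c|
    rw [abs_of_nonneg (by linarith)]
    linarith
  · refine (min_le_right _ _).trans (measure_mono fun t (ht : t ≤ -2) => ?_)
    show 2 ≤ |t - c|
    rw [abs_of_nonpos (by linarith)]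
    linarith

/-- The Gaussian intermediate-velocity mass `min (γ₁ [2, ∞)) (γ₁ (-∞, -2])` is positive. [folklore] -/
theorem min_gaussianReal_tails_ne_zero :
    min (gaussianReal 0 1 (Set.Ici 2)) (gaussianReal 0 1 (Set.Iic (-2))) ≠ 0 := by
  refine (lt_min (gaussianReal_pos_of_volume_pos ?_) (gaussianReal_pos_of_volume_pos ?_)).ne'
  · simp [Real.volume_Ici]
  · simp [Real.volume_Iic]

/-- **Gaussian hard-rod coercivity.** For the standard Gaussian `γ₁` on `ℝ` and measurable `a`,
`∫∫ (a c - a s)² dγ₁ dγ₁ ≤ C_γ ∫∫ |c - s| (a c - a s)² dγ₁ dγ₁` with the finite constant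
`C_γ = 1 + 4 / min (γ₁ [2, ∞)) (γ₁ (-∞, -2])`. This is the coercivity (spectral gap on mean-zero
functions) of the one-dimensional hard-rod linear Boltzmann form against a Gaussian bath.
[cite: BarangerMouhot2005, §2 (proof of Thm 1.1)] -/
theorem lintegral_sq_sub_le_hardRod_gaussianReal {a : ℝ → ℝ} (ha : Measurable a) :
    ∫⁻ c, ∫⁻ s, ENNReal.ofReal ((a c - a s) ^ 2) ∂gaussianReal 0 1 ∂gaussianReal 0 1 ≤
      (1 + 4 * (min (gaussianReal 0 1 (Set.Ici 2)) (gaussianReal 0 1 (Set.Iic (-2))))⁻¹) *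
        ∫⁻ c, ∫⁻ s, ENNReal.ofReal (|c - s| * (a c - a s) ^ 2)
          ∂gaussianReal 0 1 ∂gaussianReal 0 1 :=
  lintegral_sq_sub_le_hardRod ha _ min_gaussianReal_tails_ne_zero
    min_gaussianReal_le_measure_two_le_abs_sub

/-- The Gaussian hard-rod coercivity constant is finite. [folklore] -/
theorem hardRod_gaussianReal_const_ne_top :
    (1 + 4 * (min (gaussianReal 0 1 (Set.Ici 2)) (gaussianReal 0 1 (Set.Iic (-2))))⁻¹) ≠ ⊤ := by
  refine ENNReal.add_ne_top.2 ⟨ENNReal.one_ne_top, ENNReal.mul_ne_top (by norm_num) ?_⟩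
  exact ENNReal.inv_ne_top.2 min_gaussianReal_tails_ne_zero

end

end Literature.Analysis.UnboundedOperators
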